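import Summits.BirchSwinnertonDyer.BirchSwinnertonDyer.Theses.ClassRecordThree
import Summits.BirchSwinnertonDyer.BirchSwinnertonDyer.Theorems.ClassRecordThreeHalvesAtThreeValueContinuity

/-! # Glue of the layer-2 split of `ClassRecordThree.HalvesAtThree` (item 19495)

`HalvesAtThreeOfChildren : ValueContinuityAtThree → IMCDivTwoLociAtThree → HalvesAtThree` is thmc-p1's
`classRecordThree_halvesAtThree_of_valueContinuity_of_imcDivStub` (p421546) verbatim: the two children are
by construction the types of its binders `hVC` and `h3`. -/

namespace Summit.BirchSwinnertonDyer.BirchSwinnertonDyer.Theorems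

/-- closes glue item stmt-BirchSwinnertonDyer-19495. -/
theorem halvesAtThreeOfChildren_holds :
    Summit.BirchSwinnertonDyer.BirchSwinnertonDyer.Theses.ClassRecordThree.HalvesAtThreeOfChildren :=
  fun hVC h3 ↦ classRecordThree_halvesAtThree_of_valueContinuity_of_imcDivStub hVC h3

end Summit.BirchSwinnertonDyer.BirchSwinnertonDyer.Theorems
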